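import Summits.CriticalPhenomena.Ising3DConformalLimit.Theorems.EnergyNotSigmaSquaredGapForcesFarMergingSandwichDefs
import HarnessLib

/-!
# Objects of the line `one-cluster-depletion-sandwich` (crux `GapForcesFarMerging`, item stmt-CriticalPhenomena-4468), part 2:
# the regularity-corrected currencies of the reshape v4 (lead seat c1, end of cycle 1)

Companion of `EnergyNotSigmaSquaredGapForcesFarMergingSandwichDefs.lean` (same namespace). Kept in a separate module because the
first Defs file is append-only and at its size limit. Contents: `EventualDoubling θ`, `MeetDominationReg` (MD′),
`HazardDominationReg` (C2″), and the sorry-free glue `hazardDominationReg_of_ext`, `hazardDominationReg_of_AD_MD`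
(registered on the crux item; statement of work of the v4 skeleton `Cruxes/GapForcesFarMerging/Lines/one-cluster-depletion-sandwich.lean`).
-/

noncomputable section

namespace Summit.CriticalPhenomena.Ising3DConformalLimit.GapForcesFarMergingSandwich

open scoped symmDiff ENNReal
open MeasureTheory Filter
open Literature.Probability.LatticeModels Literature.Probability.Percolation

/-! ## Regularity at the octave itself (lead seat c1, end of cycle 1): the wave-2 `stub-misstated` on (MD)
The (MD) worker landed the exact same-point re-rooting identity (`meetDomination_reroot` p111921), the first moment (p112570),
doubling abundance (p112132), the `1/N` identity + reduction (p114355), and returned `stub-misstated`: each comparison with a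
dilated shape at octave `k` passes through the exact densities `G_n(a,v)G_n(v,b)/G_n(a,b)` at separations `≍ 2^k` in different
directions, i.e. through `Doubling θ k`, which `Doubling θ K` does not supply off `[K-3,K+3]`. The corrected currencies carry
it; the counting then needs `EventualDoubling`, supplied by the existing crux item stmt-CriticalPhenomena-6150
`MirrorHoelderCompactness.TwoPointDoubling` (open; the axis ratios `↑ 1` without rate, `criticalTwoPoint_axis_ratio_tendsto_one`). -/

/-- EVENTUAL DOUBLING with constant `θ`: all large octaves carry a `θ`-window (⇐ item stmt-CriticalPhenomena-6150). [cite: AizenmanDuminilCopinAnnals2021, Def. 5.11 (P1) and Rem. 5.10] -/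
def EventualDoubling (θ : ℝ) : Prop := ∀ᶠ k : ℕ in atTop, Doubling θ k

/-- (MD′) MEET DOMINATION AT A DOUBLING OCTAVE (`MeetDomination` + hypothesis `Doubling θ k`). Statement of the registered (open)
stub `stub_meetDominationReg`; follows from the re-rooted domination RD (`meetDomination_of_rerootDomination`, p114355), whose
open core is the multiplicative far-endpoint relocation for four independent sourced currents through a common vertex
(route-posited currency of the line, not a literature fact). -/
def MeetDominationReg : Prop :=
  ∀ θ : ℝ, 0 < θ → ∃ M k₁ : ℕ, ∃ C : ℝ, ∃ ε : ℕ → ℝ, Tendsto ε atTop (nhds 0) ∧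
    ∀ k K : ℕ, 1 ≤ k → k ≤ 5 * K + 3 → Doubling θ K → Doubling θ k → ∀ᶠ n : ℕ in atTop, ∀ c : ℝ,
      (∀ y : Fin 4 → Site 3, Function.Injective y → (∀ i, y i ∈ box 3 M) →
          ∀ j : ℕ, k ≤ j + k₁ → j ≤ k + 2 → meet n (fun i => ((2 : ℤ) ^ j) • y i) ≤ c) →
        meetAnn n k K ≤ C * c + ε k

/-- (C2″) HAZARD DOMINATION AT A DOUBLING OCTAVE (`HazardDominationExt` + hypothesis `Doubling θ k`); conclusion of the glue
`hazardDominationReg_of_AD_MD`, hypothesis of the registered stub `stub_octaveCountingReg` (route-posited currency, not a literature fact). -/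
def HazardDominationReg : Prop :=
  ∀ θ : ℝ, 0 < θ → ∃ M k₁ : ℕ, ∃ C : ℝ, ∃ ε : ℕ → ℝ, Tendsto ε atTop (nhds 0) ∧
    ∀ k K : ℕ, 1 ≤ k → k ≤ 5 * K + 3 → Doubling θ K → Doubling θ k → ∀ᶠ n : ℕ in atTop, ∀ c : ℝ,
      (∀ y : Fin 4 → Site 3, Function.Injective y → (∀ i, y i ∈ box 3 M) →
          ∀ j : ℕ, k ≤ j + k₁ → j ≤ k + 2 → meet n (fun i => ((2 : ℤ) ^ j) • y i) ≤ c) →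
        avoidIn n (2 ^ (k - 1)) (pinch K) - avoidIn n (2 ^ k) (pinch K) ≤
          (C * c + ε k) * avoidIn n (2 ^ (k - 1)) (pinch K)

/-- `HazardDominationExt` is the doubling-free strengthening of `HazardDominationReg`. [folklore] -/
theorem hazardDominationReg_of_ext (h : HazardDominationExt) : HazardDominationReg := by
  intro θ hθ
  obtain ⟨M, k₁, C, ε, hε, hdom⟩ := h θ hθ
  exact ⟨M, k₁, C, ε, hε, fun k K hk hkK hD _ => hdom k K hk hkK hD⟩

/-- **(AD) ∧ (MD′) ⟹ hazard domination at every doubling octave** (same algebra as `hazardDominationExt_of_AD_MD`). [folklore] -/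
theorem hazardDominationReg_of_AD_MD : AvoidanceDomination → MeetDominationReg → HazardDominationReg := by
  intro hAD hMD θ hθ
  obtain ⟨C₁, ε₁, hε₁, had⟩ := hAD θ hθ
  obtain ⟨M, k₁, C₂, ε₂, hε₂, hmd⟩ := hMD θ hθ
  refine ⟨M, k₁, max C₁ 0 * C₂, fun k => max C₁ 0 * ε₂ k + ε₁ k, ?_, ?_⟩
  · simpa using (hε₂.const_mul (max C₁ 0)).add hε₁
  · intro k K hk hkK hD hDk
    filter_upwards [had k K hk hkK hD, hmd k K hk hkK hD hDk] with n hn hm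
    intro c hc
    have hA : 0 ≤ avoidIn n (2 ^ (k - 1)) (pinch K) := measureReal_nonneg
    have hmeet : meetAnn n k K ≤ C₂ * c + ε₂ k := hm c hc
    have hC₁ : C₁ ≤ max C₁ 0 := le_max_left _ _
    have h0 : 0 ≤ max C₁ 0 := le_max_right _ _
    have hmn : 0 ≤ meetAnn n k K := measureReal_nonneg
    calc avoidIn n (2 ^ (k - 1)) (pinch K) - avoidIn n (2 ^ k) (pinch K)
        ≤ (C₁ * meetAnn n k K + ε₁ k) * avoidIn n (2 ^ (k - 1)) (pinch K) := hn
      _ ≤ (max C₁ 0 * meetAnn n k K + ε₁ k) * avoidIn n (2 ^ (k - 1)) (pinch K) := by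
          apply mul_le_mul_of_nonneg_right _ hA
          nlinarith
      _ ≤ (max C₁ 0 * (C₂ * c + ε₂ k) + ε₁ k) * avoidIn n (2 ^ (k - 1)) (pinch K) := by
          apply mul_le_mul_of_nonneg_right _ hA
          nlinarith [mul_le_mul_of_nonneg_left hmeet h0]
      _ = (max C₁ 0 * C₂ * c + (max C₁ 0 * ε₂ k + ε₁ k)) * avoidIn n (2 ^ (k - 1)) (pinch K) := by ring

end Summit.CriticalPhenomena.Ising3DConformalLimit.GapForcesFarMergingSandwich

end
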